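import Summits.BirchSwinnertonDyer.Rank1Residual.Supersingular.X6RankZeroInertPairDefs
import Literature.NumberTheory.EllipticCurves.NonvanishingTwistsPrescribedInertSimpleZero
import Literature.NumberTheory.EllipticCurves.RootNumberEvenAnalyticRankProofs
import HarnessLib

/-!
# Leaf `ClassX6 ∧ r_an = 0` — road (R2): the rank-ZERO inert-pair FIELD SUPPLY applied on the sub-class
# (cell `bsd-print-x6`, typer seat `ty2`; sibling of `X6RankZeroInertPairDefs.lean` / `…Interface.lean`)

HONEST FRAMING (cell `bsd-print-x6`, run/shared/lean/pub/bsd-print-x6/README.md): THIS FILE books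
nothing, asserts nothing about any curve, introduces NO definition and NO named fact (debt 0). It is
the twin, for seat p3-g2's inert-pair road (R2) (PLAN.md v4.2 (R2); INBOX 2026-08-27T19:01:22Z /
19:39:21Z), of `X6RankZeroErratumInterface.lean` §5 (road (E)): the rank-zero FIELD SUPPLY — seat
p3-g2's named fact `friedbergHoffstein_exists_twist_simpleZero_inertAt_splitAt` (p561450; Friedberg–
Hoffstein 1995 Thm. B, second alternative, with prescribed INERT primes; statement-only, its own tier
and flags `FH95-text-not-held` / `B2-via-Zbl-review`) — APPLIED on `X6RankZero ∧ HasInertPair`, every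
hypothesis DISCHARGED on the leaf: `w(E) = +1` ⇐ `r_an = 0` and modularity `hnf`
(`rootNumber_eq_neg_one_pow_analyticRank_of_exists_isNewformOf`, PROVED); `S = {ℓ₁, ℓ₂}` multiplicative,
`Even S.card`, `S.Nonempty` ⇐ the `HasInertPair` witness; `p` good ⇐ class X6. Output = the inert-pair
field SHAPE consumed by `X6RankZeroInertPairInterface.lean` §2–§4 (`hKiq`, `hinert`, `hsplit`, `h2`,
`hHp`) together with the witness clauses (`h₁ h₂ hram₁ hram₂`) and the simple zero of `L(E^{(d_K)}, s)`
at `s = 1` (so `E/K` has analytic rank one: the Heegner point on `X_{N⁺,N⁻}` is non-torsion). Kept out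
of the Interface (400-line cap) and out of the defs module (kept light for seat ty3's certificates).

References: [FriedbergHoffstein1995] Thm. B; [JetchevSkinnerWan2017] §7.4.2 (p. 31), §4.1 (H) (p. 17);
[BumpFriedbergHoffstein1990] Thm. (i); sibling `X6RankZeroErratumInterface.lean` §5.
-/

noncomputable section

open scoped Classical

open WeierstrassCurve NumberField
  Literature.NumberTheory.EllipticCurves Literature.NumberTheory.EllipticCurves.Rank1Residual
  Literature.NumberTheory.EllipticCurves.ModularForms

set_option autoImplicit false

namespace Summit.BirchSwinnertonDyer.Rank1Residual.Supersingular

section Supply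

variable (W : WeierstrassCurve ℚ) [W.IsElliptic] [W.IsGloballyMinimal] (p : ℕ) [Fact p.Prime]

omit [W.IsGloballyMinimal] in
/-- **Unpacking seat p3-g2's supply fact at a PAIR `S = {ℓ₁, ℓ₂}`, bound `B = 0`** (the shape of
Jetchev–Skinner–Wan 2017 §7.4.2's `K″` with a SIMPLE zero instead of non-vanishing): for `W` with
`w(E) = +1`, two distinct multiplicative primes `ℓ₁, ℓ₂` and a good prime `p`, an imaginary quadratic
`K` with `ℓ₁, ℓ₂` inert (`ℓ_i ∤ d_K`), every other prime of `N_W` split, `2` split if `2 ∤ N_W`, `p`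
split, and `ord_{s=1} L(E^{(d_K)}, s) = 1`. CONDITIONAL on the named fact; nothing booked.
[cite: FriedbergHoffstein1995, Thm. B, second alternative] [cite: JetchevSkinnerWan2017, §7.4.2 (arXiv:1512.06894 p. 31)] -/
theorem exists_inertAt_pair_splitAt_twist_simpleZero
    (hFH : friedbergHoffstein_exists_twist_simpleZero_inertAt_splitAt) (hw : W.rootNumber = 1)
    {ℓ₁ ℓ₂ : ℕ} [Fact ℓ₁.Prime] [Fact ℓ₂.Prime] (hne : ℓ₁ ≠ ℓ₂) (h₁ : Mult W ℓ₁) (h₂ : Mult W ℓ₂)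
    (hgood : Good W p) :
    ∃ (K : Type) (_ : Field K) (_ : NumberField K),
      IsImaginaryQuadratic K ∧
        (∀ ℓ ∈ ({ℓ₁, ℓ₂} : Finset ℕ), ((Ideal.span {(ℓ : ℤ)}).primesOver (𝓞 K)).ncard = 1 ∧
          ¬ (ℓ : ℤ) ∣ NumberField.discr K) ∧
        (∀ ℓ : ℕ, ℓ.Prime → ℓ ∣ W.conductorNorm ℤ → ℓ ∉ ({ℓ₁, ℓ₂} : Finset ℕ) →
          ((Ideal.span {(ℓ : ℤ)}).primesOver (𝓞 K)).ncard = 2) ∧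
        (¬ 2 ∣ W.conductorNorm ℤ → ((Ideal.span {(2 : ℤ)}).primesOver (𝓞 K)).ncard = 2) ∧
        SatisfiesHeegnerHypothesis p K ∧
          (W.quadraticTwist (NumberField.discr K : ℚ)).entireLFunction 1 = 0 ∧
          deriv (W.quadraticTwist (NumberField.discr K : ℚ)).entireLFunction 1 ≠ 0 := by
  have hS : ∀ ℓ ∈ ({ℓ₁, ℓ₂} : Finset ℕ), ∃ _ : Fact ℓ.Prime, W.HasMultiplicativeReductionAtPrime ℓ := by
    intro ℓ hℓ
    rcases Finset.mem_insert.mp hℓ with rfl | hℓ2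
    · exact ⟨‹_›, h₁⟩
    · rw [Finset.mem_singleton] at hℓ2
      subst hℓ2
      exact ⟨‹_›, h₂⟩
  have heven : Even ({ℓ₁, ℓ₂} : Finset ℕ).card := by
    rw [Finset.card_pair hne]
    exact even_two
  obtain ⟨K, hF, hNF, hK, -, hin, hsplit, h2, hHp, hL0, hL1⟩ :=
    hFH W hw {ℓ₁, ℓ₂} hS heven ⟨ℓ₁, Finset.mem_insert_self ℓ₁ {ℓ₂}⟩ p hgood 0
  exact ⟨K, hF, hNF, hK, hin, hsplit, h2, hHp, hL0, hL1⟩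

/-- **On the inert-pair sub-class of the leaf, the rank-zero inert-pair datum's FIELD exists, by
name.** For an X6 pair `(W, p)` with `ord_{s=1} L(E,s) = 0` and `HasInertPair W p`: there are primes
`ℓ₁ ≠ ℓ₂` — multiplicative with `E[p]` ramified at both — and an imaginary quadratic `K` with `ℓ₁, ℓ₂`
inert (`ℓ_i ∤ d_K`), every other prime of `N_W` split, `2` split if `2 ∤ N_W`, `p` split, and
`L(E^{(d_K)},1) = 0`, `L'(E^{(d_K)},1) ≠ 0` (so `E/K` has analytic rank one and `w(E/K) = −1`, the
generalized Heegner hypothesis with `N⁻ = ℓ₁ℓ₂`). The hypotheses of the named fact `hFH` DISCHARGED on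
the leaf: `w(E) = +1` ⇐ `r_an = 0` and modularity `hnf` (PROVED parity
`rootNumber_eq_neg_one_pow_analyticRank_of_exists_isNewformOf`); `S = {ℓ₁, ℓ₂}` ⇐ the witness; `p`
good ⇐ X6. Output in the inert-pair SHAPE spelling consumed by `X6RankZeroInertPairInterface.lean`
§2–§4 and by seat p3-g2's `…AnticyclotomicRankZeroInertPair` chain. CONDITIONAL on the named fact
(flags `FH95-text-not-held`, `B2-via-Zbl-review`; tier is the referee's call); nothing booked.
[cite: FriedbergHoffstein1995, Thm. B, second alternative] [cite: JetchevSkinnerWan2017, §7.4.2 (p. 31) and §4.1 (H) (p. 17)] -/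
theorem X6RankZero.exists_inertPairShapeField_of_hasInertPair
    (hFH : friedbergHoffstein_exists_twist_simpleZero_inertAt_splitAt) (hnf : exists_isNewformOf)
    (hX : ClassX6 W p) (hr : W.analyticRank = 0) (h : HasInertPair W p) :
    ∃ (ℓ₁ ℓ₂ : ℕ) (_ : Fact ℓ₁.Prime) (_ : Fact ℓ₂.Prime) (K : Type) (_ : Field K) (_ : NumberField K),
      ℓ₁ ≠ ℓ₂ ∧ Mult W ℓ₁ ∧ Mult W ℓ₂ ∧
        ¬ p ∣ padicValInt ℓ₁ W.minimalDiscriminantInt ∧ ¬ p ∣ padicValInt ℓ₂ W.minimalDiscriminantInt ∧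
      IsImaginaryQuadratic K ∧
        (∀ ℓ ∈ ({ℓ₁, ℓ₂} : Finset ℕ), ((Ideal.span {(ℓ : ℤ)}).primesOver (𝓞 K)).ncard = 1 ∧
          ¬ (ℓ : ℤ) ∣ NumberField.discr K) ∧
        (∀ ℓ : ℕ, ℓ.Prime → ℓ ∣ W.conductorNorm ℤ → ℓ ∉ ({ℓ₁, ℓ₂} : Finset ℕ) →
          ((Ideal.span {(ℓ : ℤ)}).primesOver (𝓞 K)).ncard = 2) ∧
        (¬ 2 ∣ W.conductorNorm ℤ → ((Ideal.span {(2 : ℤ)}).primesOver (𝓞 K)).ncard = 2) ∧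
        SatisfiesHeegnerHypothesis p K ∧
          (W.quadraticTwist (NumberField.discr K : ℚ)).entireLFunction 1 = 0 ∧
          deriv (W.quadraticTwist (NumberField.discr K : ℚ)).entireLFunction 1 ≠ 0 := by
  obtain ⟨ℓ₁, ℓ₂, i₁, i₂, hne, h₁, h₂, hr₁, hr₂⟩ := h
  have hw : W.rootNumber = 1 := by
    rw [WeierstrassCurve.rootNumber_eq_neg_one_pow_analyticRank_of_exists_isNewformOf hnf W, hr,
      pow_zero]
  obtain ⟨K, hF, hNF, hK, hin, hsplit, h2, hHp, hL0, hL1⟩ :=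
    exists_inertAt_pair_splitAt_twist_simpleZero W p hFH hw hne h₁ h₂ hX.1.1
  exact ⟨ℓ₁, ℓ₂, i₁, i₂, K, hF, hNF, hne, h₁, h₂, hr₁, hr₂, hK, hin, hsplit, h2, hHp, hL0, hL1⟩

end Supply

end Summit.BirchSwinnertonDyer.Rank1Residual.Supersingular

end
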